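import Summits.BirchSwinnertonDyer.BirchSwinnertonDyer.Theorems.ManinLocalTwoThreeNotTrivialEisensteinCyclotomic
import Summits.BirchSwinnertonDyer.BirchSwinnertonDyer.Theorems.ManinLocalTwoThreeCyclotomicInertia
import Literature.NumberTheory.EllipticCurves.CuspFormLFunctionLevelConductorProofs
import Literature.NumberTheory.EllipticCurves.NewformPeterssonSizeSymmSquareProofs
import Literature.NumberTheory.EllipticCurves.RootNumberTwistProofs
import Literature.NumberTheory.EllipticCurves.ModularityVersionApProofs
import HarnessLib

/-!
# E-es-40 `NotTrivialEisensteinOfIrreducibleTwo` is a theorem (stub 5 of line `kato_shift_two`, crux C2 `ManinOddAtFour`)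

Route `ManinLocalTwoThree` (cell bsd-f2-manin), crux C2 `ManinOddAtFour` (stmt-BirchSwinnertonDyer-22967), line `kato_shift_two`
(skeleton v8, `Cruxes/ManinOddAtFour/Lines/kato_shift_two.lean`), registered stub 5
`stub_notTrivialEisensteinTwo : NotTrivialEisensteinOfIrreducibleTwo` (the cell's candidate E-es-40, tagged `@[conjecture]` in
`Summits/BirchSwinnertonDyer/Rank1Residual/ManinAdditive/NotTrivialEisensteinOfIrreducible.lean`).  This file PROVES it,
unconditionally, assembling the lead's chain

* `t = 2`: `notTrivialEisensteinOfIrreducibleAtTwo_holds` (p610460; Chebotarev on `W[2^{M+1}]`);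
* `t` odd: Theorem A/B (p612387), Theorem C (p613173), Theorem D (p613850:
  `exists_prime_modEq_one_lFunction_odd_of_inertia_transitive`) and the total-ramification input
  `exists_mem_inertia_rat_smul_eq_of_isPrimitiveRoot` (p614872),

with the two routine reductions done here:

* **`hasGoodReductionAt_or_hasMultiplicativeReductionAt_of_isNewformOf`** — the newform-level bridge: `f` the newform of `V` at
  level `N`, `t` prime, `t² ∤ N` ⟹ `V` is good or multiplicative at the place over `t` (`t ∤ N`: `t ∤ N_V` by
  `IsNewformOf.dvd_level_iff_dvd_conductorNorm`, hence good by `dvd_conductorNorm_iff`; `t ∥ N`: `a_t(f)² = 1` by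
  `IsNewform0.cuspCoeff_sq_eq_one_of_dvd_of_not_sq_dvd`, incompatible with `a_t(V) = 0` forced by additive reduction,
  `LFunction_apply_eq_zero_of_hasAdditiveReductionAt`, and the local trichotomy);
* the passage to a global minimal model `C • W` (`hasGlobalMinimalModel_rat_holds`, `LFunction_smul`,
  `Mazur1978.hasIrreducibleModPGaloisRep_smul_iff`), needed because Theorems A–D read `a_r` off the reduction of a minimal model.

Main results: `notTrivialEisensteinOfIrreducibleTwo_holds : NotTrivialEisensteinOfIrreducibleTwo` and the registered stub BY NAME
`Summit.BirchSwinnertonDyer.BirchSwinnertonDyer.Theorems.stub_notTrivialEisensteinTwo`.  After this file the line's open stubs are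
`stub_katoFactTwoReal` (Kato F♯, Literature), `stub_sl2OddPrimeExtensionFact` (F-es-27′), `stub_gamma0AwayExtensionFact` (E-es-43)
and `stub_minimalReducibleResidual` (orbit-minimal reducible residual) — see `ManinLocalTwoThreeManinOddAtFourOfFourFacts`, whose
input `hNT` is now discharged.  No new definitions; axioms standard.  Nothing about BSD or Manin's conjecture itself is proved here.
References: J.-P. Serre, Invent. Math. 15 (1972) §4; J. Tate, GCFT §2.4 (Chebotarev); F. Diamond–J. Shurman, GTM 228, §8.3;
L. Washington, GTM 83, Prop. 2.3.
-/

set_option autoImplicit false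
set_option linter.dupNamespace false

noncomputable section

open scoped Classical MatrixGroups ModularForm

open NumberField IsDedekindDomain CongruenceSubgroup
  Literature.NumberTheory.EllipticCurves Literature.NumberTheory.EllipticCurves.ModularForms
  Literature.NumberTheory.GaloisRepresentations Summit.BirchSwinnertonDyer.Rank1Residual.ManinAdditive

namespace Summit.BirchSwinnertonDyer.BirchSwinnertonDyer.Theorems.ManinLocalTwoThree

/-- **Newform-level bridge.**  If `f` is the newform of `V` at level `N` and `t` is a prime with `t² ∤ N`, then `V` has good or
multiplicative reduction at the place `v` over `t`: for `t ∤ N`, `t ∤ N_V` (`IsNewformOf.dvd_level_iff_dvd_conductorNorm`) so `V` is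
good at `v` (`dvd_conductorNorm_iff`); for `t ∥ N`, `a_t(f)² = 1` (`IsNewform0.cuspCoeff_sq_eq_one_of_dvd_of_not_sq_dvd`) while
additive reduction would force `a_t(V) = 0` (`LFunction_apply_eq_zero_of_hasAdditiveReductionAt`).
[cite: DiamondShurman2005, §8.3 (PDF p. 353)] -/
theorem hasGoodReductionAt_or_hasMultiplicativeReductionAt_of_isNewformOf (V : WeierstrassCurve ℚ) [V.IsElliptic]
    {N : ℕ} [NeZero N] {f : CuspForm (Gamma0 N) 2} (hf : IsNewformOf V f) {t : ℕ} (ht : t.Prime) (ht2N : ¬ t ^ 2 ∣ N)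
    {v : HeightOneSpectrum (𝓞 ℚ)} (hvt : (Rat.HeightOneSpectrum.primesEquiv v : ℕ) = t) :
    V.HasGoodReductionAt v ∨ V.HasMultiplicativeReductionAt v := by
  haveI : Fact t.Prime := ⟨ht⟩
  by_cases htN : t ∣ N
  · rcases WeierstrassCurve.hasGoodReductionAt_or_hasMultiplicativeReductionAt_or_hasAdditiveReductionAt v V with hg | hm | ha
    · exact Or.inl hg
    · exact Or.inr hm
    · exfalso
      have h1 : cuspCoeff f t ^ 2 = 1 := hf.1.cuspCoeff_sq_eq_one_of_dvd_of_not_sq_dvd ht htN ht2N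
      have h0 : V.LFunction t = 0 := V.LFunction_apply_eq_zero_of_hasAdditiveReductionAt hvt ha (dvd_refl t)
      rw [hf.2 t, h0] at h1
      norm_num at h1
  · left
    by_contra hbad
    have h : (Rat.HeightOneSpectrum.primesEquiv v : ℕ) ∣ V.conductorNorm ℤ := (V.dvd_conductorNorm_iff v).mpr hbad
    rw [hvt] at h
    exact htN ((hf.dvd_level_iff_dvd_conductorNorm ht).mpr h)

/-- **E-es-40 holds**: for `W / ℚ` with newform `f` of level `N`, `W[2]` irreducible, a prime `t` with `t = 2 ∨ t² ∤ N`, a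
finite set `S` and `M ≥ 0`, there is a prime `r ∉ S`, `r ≡ 1 (mod t^M)`, with `a_r(W) ≢ r + 1 (mod 2)`.  Proof: `t = 2` is
`notTrivialEisensteinOfIrreducibleAtTwo_holds` (p610460); for odd `t` pass to a global minimal model `C • W`
(`hasGlobalMinimalModel_rat_holds`, `LFunction_smul`, `Mazur1978.hasIrreducibleModPGaloisRep_smul_iff`), which is good or
multiplicative at `t` by the bridge above, and apply Theorem D's assembled form
`exists_prime_modEq_one_lFunction_odd_of_inertia_transitive` (p613850) with its transitivity input discharged by
`exists_mem_inertia_rat_smul_eq_of_isPrimitiveRoot` (total ramification of `ℚ(ζ_{t^{M+1}})` at `t`).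
[cite: Serre1972, §4] [cite: TateGCFT1967, §2.4 (Tchebotarev density theorem)] -/
theorem notTrivialEisensteinOfIrreducibleTwo_holds : NotTrivialEisensteinOfIrreducibleTwo := by
  intro W _ N _ f hf hirr t ht htc S M
  classical
  by_cases ht2 : t = 2
  · subst ht2
    exact notTrivialEisensteinOfIrreducibleAtTwo_holds W hirr S M
  have ht2N : ¬ t ^ 2 ∣ N := htc.resolve_left ht2
  obtain ⟨C, hC⟩ := WeierstrassCurve.hasGlobalMinimalModel_rat_holds W
  haveI := hC
  have hirr' : (C • W).HasIrreducibleModPGaloisRep 2 :=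
    (Mazur1978.hasIrreducibleModPGaloisRep_smul_iff W C 2).mpr hirr
  have hf' : IsNewformOf (C • W) f :=
    ⟨hf.1, fun n ↦ by rw [WeierstrassCurve.LFunction_smul W C]; exact hf.2 n⟩
  obtain ⟨v, hvt⟩ : ∃ v : HeightOneSpectrum (𝓞 ℚ), (Rat.HeightOneSpectrum.primesEquiv v : ℕ) = t :=
    ⟨Rat.HeightOneSpectrum.primesEquiv.symm ⟨t, ht⟩, by rw [Equiv.apply_symm_apply]⟩
  have hv : (t : 𝓞 ℚ) ∈ v.asIdeal := by
    have h := Mazur1978.natCast_natGenerator_mem_asIdeal v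
    rwa [show (Rat.HeightOneSpectrum.natGenerator v : ℕ) = t from hvt] at h
  obtain ⟨𝔓, h𝔓⟩ := v.primesAbove_nonempty
  have hred := hasGoodReductionAt_or_hasMultiplicativeReductionAt_of_isNewformOf (C • W) hf' ht ht2N hvt
  have h := exists_prime_modEq_one_lFunction_odd_of_inertia_transitive (C • W) hirr' ht ht2 hv hred h𝔓 S M
    fun ζ hζ g ↦ exists_mem_inertia_rat_smul_eq_of_isPrimitiveRoot ht M hv h𝔓 hζ g
  rwa [WeierstrassCurve.LFunction_smul W C] at h

end Summit.BirchSwinnertonDyer.BirchSwinnertonDyer.Theorems.ManinLocalTwoThree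

namespace Summit.BirchSwinnertonDyer.BirchSwinnertonDyer.Theorems

/-- **Stub 5 of line `kato_shift_two` v8 (crux C2 `ManinOddAtFour`, stmt-BirchSwinnertonDyer-22967), registered signature verbatim:
`stub_notTrivialEisensteinTwo : NotTrivialEisensteinOfIrreducibleTwo`** — PROVED
(`ManinLocalTwoThree.notTrivialEisensteinOfIrreducibleTwo_holds`). [cite: TateGCFT1967, §2.4 (Tchebotarev density theorem)] -/
theorem stub_notTrivialEisensteinTwo : NotTrivialEisensteinOfIrreducibleTwo :=
  ManinLocalTwoThree.notTrivialEisensteinOfIrreducibleTwo_holds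

end Summit.BirchSwinnertonDyer.BirchSwinnertonDyer.Theorems

end
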